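import Literature.NumberTheory.Transcendental.SemialgebraicMonotonicity
import Literature.NumberTheory.Transcendental.SemialgebraicGrounding
import Literature.ModelTheory.ExponentialFields.OMinimalIntervals
import HarnessLib

/-!
# Monotonicity theorem for semialgebraic functions — I: definability and o-minimality on the line

First of two files proving the named fact
`Literature.NumberTheory.Transcendental.semialgebraic_monotonicity` (van den Dries 1998, Ch. 3
(1.2), for `ℚ`-semialgebraic functions of one real variable; file
`SemialgebraicMonotonicity.lean`). The proof follows van den Dries, *Tame Topology and O-minimal
Structures*, Ch. 3 §1, inside the o-minimal structure of **real** semialgebraic sets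
(`Literature.ModelTheory.ExponentialFields.IsSemialgebraic ℝ`, coefficients `k = ℝ`): a
`ℚ`-semialgebraic graph is `ℝ`-semialgebraic (`isSemialgebraic_real_of`), and only the real
structure is closed under the real parameters (`x`, `f x`, …) that the o-minimal arguments use.
This file supplies the two inputs of those arguments:

* **Definability kit** (`sa_and`, …, `sa_exists`, `sa_forall`, `sa_graph`, `sa_frel`, …): Boolean
  combinations, polynomial (in)equalities, coordinate changes and — by the Tarski–Seidenberg theorem
  proved in the tree (`Literature.ModelTheory.ExponentialFields.tarski_seidenberg_real_holds`) —
  quantifiers over the last coordinate preserve real-semialgebraicity of subsets of `ℝⁿ`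
  (`Fin n → ℝ`). First-order formulas about a function `f` with semialgebraic graph over `(a, b)`
  are handled through *guarded* atoms `z i ∈ (a, b) ∧ z j ∈ (a, b) ∧ r (f (z i)) (f (z j))`
  (`sa_frel`), which are projections of the graph.
* **O-minimality of the real field on the line** in the form used in Ch. 3 §1
  (`exists_finset_Ioo_subset_or_disjoint`): a real-semialgebraic `A ⊆ ℝ` admits a finite set `F`
  such that every open interval avoiding `F` lies in `A` or misses `A` (from
  `FibreLength.exists_card_le_locallyConst`, i.e. sign conditions on finitely many univariate
  polynomials, plus connectedness); hence one-sided germs of `A` at every point are constant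
  (`eventually_nhdsGT_mem_or`, `eventually_nhdsLT_mem_or`) and `A` is finite unless it contains an
  interval (`finite_of_forall_not_Ioo_subset`) — van den Dries Ch. 1 (3.3).
* The definable sets of the proof: the sets of points with a given one-sided germ type
  `{x ∈ (a, b) | ∀ᶠ y in 𝓝[>] x, r (f y) (f x)}` (`sa_setOf_eventually_nhdsGT`, `…LT`; the sets
  `Φ±±` of the proof of Lemma 2), the set of discontinuity points (`sa_setOf_not_continuousAt`)
  and images of intervals (`sa_image_Ioo`, for Lemma 3).

The order-theoretic half of the proof and the theorem itself are in
`SemialgebraicMonotonicityProofs.lean`.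

## References

* [Dries1998] L. van den Dries, *Tame Topology and O-minimal Structures*, LMS LNS 248, CUP 1998,
  Ch. 1 (3.2)–(3.3) (o-minimality, finite boundary, germs), Ch. 2 (2.11)–(3.3) (the real field is
  o-minimal: semialgebraic sets), Ch. 3 §1 (1.1)–(1.5).
* [BochnakCosteRoy1998] J. Bochnak, M. Coste, M.-F. Roy, *Real Algebraic Geometry*, Springer 1998,
  Thm. 2.2.1 (Tarski–Seidenberg), Prop. 2.2.4 (first-order formulas define semialgebraic sets),
  Prop. 2.1.7 / §2.3 (semialgebraic subsets of the line are finite unions of points and intervals).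

## Design notes

* Nothing here is a named fact; no definitions. Quantifier lemmas bind the *last* coordinate and
  present the matrix through `Fin.init w` / `w (Fin.last n)`, so that first-order formulas are
  assembled top-down by `refine` with numeral coordinates (all index computations are `rfl`).
* Everything is stated for coefficients `ℝ` (`IsSemialgebraic ℝ`); `isSemialgebraic_real_of`
  moves any `k`-semialgebraic set there.
-/

open Set Filter Topology MvPolynomial
open Literature.ModelTheory.ExponentialFields

namespace Literature.NumberTheory.Transcendental

namespace SemialgebraicMonotonicity

/-! ### Definability kit for real-semialgebraic subsets of `ℝⁿ` -/

section Toolkit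

variable {n : ℕ}

/-- Conjunction of real-semialgebraic conditions is real-semialgebraic (intersection).
[cite: BochnakCosteRoy1998, Prop. 2.2.4] -/
theorem sa_and {P Q : (Fin n → ℝ) → Prop} (hP : IsSemialgebraic ℝ {z | P z})
    (hQ : IsSemialgebraic ℝ {z | Q z}) : IsSemialgebraic ℝ {z | P z ∧ Q z} :=
  hP.inter hQ

/-- Disjunction of real-semialgebraic conditions is real-semialgebraic (union).
[cite: BochnakCosteRoy1998, Prop. 2.2.4] -/
theorem sa_or {P Q : (Fin n → ℝ) → Prop} (hP : IsSemialgebraic ℝ {z | P z})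
    (hQ : IsSemialgebraic ℝ {z | Q z}) : IsSemialgebraic ℝ {z | P z ∨ Q z} :=
  hP.union hQ

/-- Negation of a real-semialgebraic condition is real-semialgebraic (complement).
[cite: BochnakCosteRoy1998, Prop. 2.2.4] -/
theorem sa_not {P : (Fin n → ℝ) → Prop} (hP : IsSemialgebraic ℝ {z | P z}) :
    IsSemialgebraic ℝ {z | ¬ P z} :=
  hP.compl

/-- Implication between real-semialgebraic conditions is real-semialgebraic.
[cite: BochnakCosteRoy1998, Prop. 2.2.4] -/
theorem sa_imp {P Q : (Fin n → ℝ) → Prop} (hP : IsSemialgebraic ℝ {z | P z})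
    (hQ : IsSemialgebraic ℝ {z | Q z}) : IsSemialgebraic ℝ {z | P z → Q z} := by
  convert hP.compl.union hQ using 1
  ext z
  simp only [mem_setOf_eq, mem_union, mem_compl_iff, imp_iff_not_or]

/-- The atom `z i < z j` is real-semialgebraic. [cite: BochnakCosteRoy1998, Def. 2.1.4] -/
theorem sa_lt (i j : Fin n) : IsSemialgebraic ℝ {z : Fin n → ℝ | z i < z j} := by
  simpa using isSemialgebraic_setOf_eval_lt (k := ℝ) (R := ℝ) (X i) (X j)

/-- The atom `z i ≤ z j` is real-semialgebraic. [cite: BochnakCosteRoy1998, Def. 2.1.4] -/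
theorem sa_le (i j : Fin n) : IsSemialgebraic ℝ {z : Fin n → ℝ | z i ≤ z j} := by
  simpa using isSemialgebraic_setOf_eval_le (k := ℝ) (R := ℝ) (X i) (X j)

/-- The atom `z i = z j` is real-semialgebraic. [cite: BochnakCosteRoy1998, Def. 2.1.4] -/
theorem sa_eq (i j : Fin n) : IsSemialgebraic ℝ {z : Fin n → ℝ | z i = z j} := by
  convert isSemialgebraic_setOf_eval_eq_zero (k := ℝ) (R := ℝ) (X i - X j : MvPolynomial (Fin n) ℝ)
    using 2 with z
  simp [sub_eq_zero]

/-- The atom `z i < c` (real constant `c`) is real-semialgebraic.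
[cite: BochnakCosteRoy1998, Def. 2.1.4] -/
theorem sa_lt_const (i : Fin n) (c : ℝ) : IsSemialgebraic ℝ {z : Fin n → ℝ | z i < c} := by
  simpa using isSemialgebraic_setOf_eval_lt (k := ℝ) (R := ℝ) (X i) (C c)

/-- The atom `c < z i` (real constant `c`) is real-semialgebraic.
[cite: BochnakCosteRoy1998, Def. 2.1.4] -/
theorem sa_const_lt (i : Fin n) (c : ℝ) : IsSemialgebraic ℝ {z : Fin n → ℝ | c < z i} := by
  simpa using isSemialgebraic_setOf_eval_lt (k := ℝ) (R := ℝ) (C c) (X i)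

/-- The atom `z i ≤ c` (real constant `c`) is real-semialgebraic.
[cite: BochnakCosteRoy1998, Def. 2.1.4] -/
theorem sa_le_const (i : Fin n) (c : ℝ) : IsSemialgebraic ℝ {z : Fin n → ℝ | z i ≤ c} := by
  simpa using isSemialgebraic_setOf_eval_le (k := ℝ) (R := ℝ) (X i) (C c)

/-- The atom `c ≤ z i` (real constant `c`) is real-semialgebraic.
[cite: BochnakCosteRoy1998, Def. 2.1.4] -/
theorem sa_const_le (i : Fin n) (c : ℝ) : IsSemialgebraic ℝ {z : Fin n → ℝ | c ≤ z i} := by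
  simpa using isSemialgebraic_setOf_eval_le (k := ℝ) (R := ℝ) (C c) (X i)

/-- The atom `z i = c` (real constant `c`) is real-semialgebraic.
[cite: BochnakCosteRoy1998, Def. 2.1.4] -/
theorem sa_eq_const (i : Fin n) (c : ℝ) : IsSemialgebraic ℝ {z : Fin n → ℝ | z i = c} := by
  convert isSemialgebraic_setOf_eval_eq_zero (k := ℝ) (R := ℝ) (X i - C c : MvPolynomial (Fin n) ℝ)
    using 2 with z
  simp [sub_eq_zero]

/-- The atom `z i ∈ (a, b)` is real-semialgebraic. [cite: BochnakCosteRoy1998, Def. 2.1.4] -/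
theorem sa_mem_Ioo (i : Fin n) (a b : ℝ) :
    IsSemialgebraic ℝ {z : Fin n → ℝ | z i ∈ Ioo a b} :=
  sa_and (sa_const_lt i a) (sa_lt_const i b)

/-- The linear atom `z i - z j < z l` is real-semialgebraic (used for `|f y - f x| < ε`).
[cite: BochnakCosteRoy1998, Def. 2.1.4] -/
theorem sa_sub_lt (i j l : Fin n) :
    IsSemialgebraic ℝ {z : Fin n → ℝ | z i - z j < z l} := by
  have h := isSemialgebraic_setOf_eval_lt (k := ℝ) (R := ℝ) (X i - X j : MvPolynomial (Fin n) ℝ) (X l)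
  simp only [map_sub, MvPolynomial.aeval_X] at h
  exact h

/-- The linear atom `z i = -z j` is real-semialgebraic (graph of `-f`).
[cite: BochnakCosteRoy1998, Def. 2.1.4] -/
theorem sa_eq_neg (i j : Fin n) :
    IsSemialgebraic ℝ {z : Fin n → ℝ | z i = -z j} := by
  have h := isSemialgebraic_setOf_eval_eq_zero (k := ℝ) (R := ℝ) (X i + X j : MvPolynomial (Fin n) ℝ)
  simp only [map_add, MvPolynomial.aeval_X] at h
  convert h using 1
  ext z
  simp only [mem_setOf_eq]
  exact eq_neg_iff_add_eq_zero

/-- Substituting coordinates: if `{z | P z} ⊆ ℝᵐ` is real-semialgebraic then so is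
`{w ∈ ℝⁿ | P (w ∘ σ)}` for any index map `σ : Fin m → Fin n` (preimage under a coordinate map).
[cite: BochnakCosteRoy1998, §2.1] -/
theorem sa_reindex {m : ℕ} {P : (Fin m → ℝ) → Prop} (hP : IsSemialgebraic ℝ {z | P z})
    (σ : Fin m → Fin n) : IsSemialgebraic ℝ {w : Fin n → ℝ | P (w ∘ σ)} :=
  hP.preimage_comp σ

/-- **Existential quantification over the last coordinate** preserves real-semialgebraicity
(Tarski–Seidenberg projection theorem, `tarski_seidenberg_real_holds`); matrix presented through
`Fin.snoc`. [cite: BochnakCosteRoy1998, Thm. 2.2.1] -/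
theorem sa_exists_snoc {P : (Fin (n + 1) → ℝ) → Prop}
    (h : IsSemialgebraic ℝ {w : Fin (n + 1) → ℝ | P w}) :
    IsSemialgebraic ℝ {z : Fin n → ℝ | ∃ t : ℝ, P (Fin.snoc z t)} := by
  convert tarski_seidenberg_real_holds (k := ℝ) h using 1
  ext z
  simp only [mem_setOf_eq, mem_image]
  constructor
  · rintro ⟨t, ht⟩
    exact ⟨Fin.snoc z t, ht, by ext i; simp [Fin.snoc_castSucc]⟩
  · rintro ⟨w, hw, rfl⟩
    refine ⟨w (Fin.last n), ?_⟩
    convert hw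
    exact Fin.snoc_init_self w

/-- **Universal quantification over the last coordinate** preserves real-semialgebraicity
(complement – projection – complement); matrix presented through `Fin.snoc`.
[cite: BochnakCosteRoy1998, Prop. 2.2.4] -/
theorem sa_forall_snoc {P : (Fin (n + 1) → ℝ) → Prop}
    (h : IsSemialgebraic ℝ {w : Fin (n + 1) → ℝ | P w}) :
    IsSemialgebraic ℝ {z : Fin n → ℝ | ∀ t : ℝ, P (Fin.snoc z t)} := by
  convert (sa_exists_snoc (sa_not h)).compl using 1
  ext z
  simp

/-- **Existential quantification over the last coordinate**, matrix presented through
`Fin.init w` and `w (Fin.last n)`: the form in which first-order formulas are assembled top-down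
(`refine sa_exists ?_`). [cite: BochnakCosteRoy1998, Thm. 2.2.1] -/
theorem sa_exists {P : (Fin n → ℝ) → ℝ → Prop}
    (h : IsSemialgebraic ℝ {w : Fin (n + 1) → ℝ | P (Fin.init w) (w (Fin.last n))}) :
    IsSemialgebraic ℝ {z : Fin n → ℝ | ∃ t : ℝ, P z t} := by
  convert sa_exists_snoc h using 3 with z
  simp [Fin.init_snoc, Fin.snoc_last]

/-- **Universal quantification over the last coordinate**, matrix presented through `Fin.init w`
and `w (Fin.last n)`. [cite: BochnakCosteRoy1998, Prop. 2.2.4] -/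
theorem sa_forall {P : (Fin n → ℝ) → ℝ → Prop}
    (h : IsSemialgebraic ℝ {w : Fin (n + 1) → ℝ | P (Fin.init w) (w (Fin.last n))}) :
    IsSemialgebraic ℝ {z : Fin n → ℝ | ∀ t : ℝ, P z t} := by
  convert sa_forall_snoc h using 3 with z
  simp [Fin.init_snoc, Fin.snoc_last]

/-- **Change of coefficients.** A `k`-semialgebraic subset of `ℝ^ι` (`k` any coefficient ring
mapping to `ℝ`, e.g. `ℚ`) is `ℝ`-semialgebraic: map the defining polynomials along
`algebraMap k ℝ`. [cite: BochnakCosteRoy1998, Def. 2.1.4] -/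
theorem isSemialgebraic_real_of {k : Type*} [CommRing k] [Algebra k ℝ] {ι : Type*}
    {s : Set (ι → ℝ)} (hs : IsSemialgebraic k s) : IsSemialgebraic ℝ s := by
  induction hs using BooleanSubalgebra.closure_bot_sup_induction with
  | mem t ht =>
    rcases ht with ⟨p, rfl⟩ | ⟨p, rfl⟩
    · convert isSemialgebraic_setOf_eval_eq_zero (k := ℝ) (R := ℝ)
        (MvPolynomial.map (algebraMap k ℝ) p) using 1
      ext x
      simp only [mem_setOf_eq, MvPolynomial.aeval_map_algebraMap]
    · convert isSemialgebraic_setOf_eval_pos (k := ℝ) (R := ℝ)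
        (MvPolynomial.map (algebraMap k ℝ) p) using 1
      ext x
      simp only [mem_setOf_eq, MvPolynomial.aeval_map_algebraMap]
  | bot => exact isSemialgebraic_empty
  | sup t _ u _ iht ihu => exact iht.union ihu
  | compl t _ iht => exact iht.compl

end Toolkit

/-! ### The graph of `f` over `(a, b)` and the guarded atoms built from it -/

section Graph

variable {f : ℝ → ℝ} {a b : ℝ}

/-- **From the vendored hypothesis to a real-semialgebraic graph.** If `f` is `ℚ`-semialgebraic
on `(a, b)` in the sense of `IsSemialgebraicFunOn ℚ` (graph over `{t : ℝ¹ | t 0 ∈ (a, b)}` via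
`Fin.snoc`), then `{(x, y) | x ∈ (a, b), y = f x} ⊆ ℝ²` is `ℝ`-semialgebraic.
[cite: BochnakCosteRoy1998, Def. 2.2.5] -/
theorem sa_graph_of_isSemialgebraicFunOn
    (hf : IsSemialgebraicFunOn ℚ {t : Fin 1 → ℝ | t 0 ∈ Ioo a b} (fun t => f (t 0))) :
    IsSemialgebraic ℝ {w : Fin 2 → ℝ | w 0 ∈ Ioo a b ∧ w 1 = f (w 0)} := by
  have h := isSemialgebraic_real_of (isSemialgebraicFunOn_iff.mp hf)
  exact h

/-- The graph atom in coordinates `(i, j)`: `z i ∈ (a, b) ∧ z j = f (z i)`.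
[cite: BochnakCosteRoy1998, Def. 2.2.5] -/
theorem sa_graph (hG : IsSemialgebraic ℝ {w : Fin 2 → ℝ | w 0 ∈ Ioo a b ∧ w 1 = f (w 0)})
    {n : ℕ} (i j : Fin n) :
    IsSemialgebraic ℝ {z : Fin n → ℝ | z i ∈ Ioo a b ∧ z j = f (z i)} :=
  sa_reindex hG ![i, j]

/-- Restricting the graph to a subinterval `(p, q) ⊆ (a, b)` keeps it real-semialgebraic.
[cite: BochnakCosteRoy1998, §2.2] -/
theorem sa_graph_mono (hG : IsSemialgebraic ℝ {w : Fin 2 → ℝ | w 0 ∈ Ioo a b ∧ w 1 = f (w 0)})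
    {p q : ℝ} (hpq : Ioo p q ⊆ Ioo a b) :
    IsSemialgebraic ℝ {w : Fin 2 → ℝ | w 0 ∈ Ioo p q ∧ w 1 = f (w 0)} := by
  convert sa_and (sa_mem_Ioo 0 p q) hG using 1
  ext w
  simp only [mem_setOf_eq]
  exact ⟨fun h => ⟨h.1, hpq h.1, h.2⟩, fun h => ⟨h.1, h.2.2⟩⟩

/-- The graph of `-f` over `(a, b)` is real-semialgebraic when that of `f` is (so every statement
below may be applied to `-f`). [cite: BochnakCosteRoy1998, Prop. 2.2.6] -/
theorem sa_graph_neg (hG : IsSemialgebraic ℝ {w : Fin 2 → ℝ | w 0 ∈ Ioo a b ∧ w 1 = f (w 0)}) :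
    IsSemialgebraic ℝ {w : Fin 2 → ℝ | w 0 ∈ Ioo a b ∧ w 1 = -f (w 0)} := by
  have key : IsSemialgebraic ℝ
      {w : Fin 2 → ℝ | ∃ u, (w 0 ∈ Ioo a b ∧ u = f (w 0)) ∧ w 1 = -u} :=
    sa_exists (sa_and (sa_graph hG 0 2) (sa_eq_neg 1 2))
  convert key using 1
  ext w
  simp only [mem_setOf_eq]
  constructor
  · rintro ⟨h0, h1⟩
    exact ⟨f (w 0), ⟨h0, rfl⟩, h1⟩
  · rintro ⟨u, ⟨h0, rfl⟩, h1⟩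
    exact ⟨h0, h1⟩

/-- **Guarded unary atom**: `z i ∈ (a, b) ∧ r (f (z i))` is real-semialgebraic for a
real-semialgebraic unary condition `r` (projection of the graph: `∃ u, (z i, u) ∈ Γ ∧ r u`).
[cite: BochnakCosteRoy1998, Prop. 2.2.4] -/
theorem sa_fval (hG : IsSemialgebraic ℝ {w : Fin 2 → ℝ | w 0 ∈ Ioo a b ∧ w 1 = f (w 0)})
    {r : ℝ → Prop} (hr : ∀ (m : ℕ) (i : Fin m), IsSemialgebraic ℝ {w : Fin m → ℝ | r (w i)})
    {n : ℕ} (i : Fin n) :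
    IsSemialgebraic ℝ {z : Fin n → ℝ | z i ∈ Ioo a b ∧ r (f (z i))} := by
  have key : IsSemialgebraic ℝ
      {z : Fin n → ℝ | ∃ u, (z i ∈ Ioo a b ∧ u = f (z i)) ∧ r u} :=
    sa_exists (sa_and (sa_graph hG (Fin.castSucc i) (Fin.last n)) (hr _ (Fin.last n)))
  convert key using 1
  ext z
  simp only [mem_setOf_eq]
  constructor
  · rintro ⟨hi, h⟩
    exact ⟨f (z i), ⟨hi, rfl⟩, h⟩
  · rintro ⟨u, ⟨hi, rfl⟩, h⟩
    exact ⟨hi, h⟩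

/-- **Guarded binary atom**: `z i ∈ (a, b) ∧ z j ∈ (a, b) ∧ r (f (z i)) (f (z j))` is
real-semialgebraic for a real-semialgebraic binary relation `r` (twice a projection of the graph:
`∃ u v, (z i, u) ∈ Γ ∧ (z j, v) ∈ Γ ∧ r u v`). This is how `f(y) < f(x)` enters first-order
formulas. [cite: BochnakCosteRoy1998, Prop. 2.2.4] -/
theorem sa_frel (hG : IsSemialgebraic ℝ {w : Fin 2 → ℝ | w 0 ∈ Ioo a b ∧ w 1 = f (w 0)})
    {r : ℝ → ℝ → Prop}
    (hr : ∀ (m : ℕ) (i j : Fin m), IsSemialgebraic ℝ {w : Fin m → ℝ | r (w i) (w j)})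
    {n : ℕ} (i j : Fin n) :
    IsSemialgebraic ℝ {z : Fin n → ℝ | z i ∈ Ioo a b ∧ z j ∈ Ioo a b ∧ r (f (z i)) (f (z j))} := by
  have key : IsSemialgebraic ℝ
      {z : Fin n → ℝ | ∃ u v, (z i ∈ Ioo a b ∧ u = f (z i)) ∧ (z j ∈ Ioo a b ∧ v = f (z j)) ∧
        r u v} := by
    refine sa_exists (sa_exists ?_)
    exact sa_and (sa_graph hG (Fin.castSucc (Fin.castSucc i)) (Fin.castSucc (Fin.last n)))
      (sa_and (sa_graph hG (Fin.castSucc (Fin.castSucc j)) (Fin.last (n + 1)))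
        (hr _ (Fin.castSucc (Fin.last n)) (Fin.last (n + 1))))
  convert key using 1
  ext z
  simp only [mem_setOf_eq]
  constructor
  · rintro ⟨hi, hj, h⟩
    exact ⟨f (z i), f (z j), ⟨hi, rfl⟩, ⟨hj, rfl⟩, h⟩
  · rintro ⟨u, v, ⟨hi, rfl⟩, ⟨hj, rfl⟩, h⟩
    exact ⟨hi, hj, h⟩

/-- **Guarded ternary atom**: `z i ∈ (a, b) ∧ z j ∈ (a, b) ∧ r (f (z i)) (f (z j)) (z l)` is
real-semialgebraic for a real-semialgebraic ternary relation `r` (used with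
`r u v e := |u - v| < e` for continuity). [cite: BochnakCosteRoy1998, Prop. 2.2.4] -/
theorem sa_frel₃ (hG : IsSemialgebraic ℝ {w : Fin 2 → ℝ | w 0 ∈ Ioo a b ∧ w 1 = f (w 0)})
    {r : ℝ → ℝ → ℝ → Prop}
    (hr : ∀ (m : ℕ) (i j l : Fin m), IsSemialgebraic ℝ {w : Fin m → ℝ | r (w i) (w j) (w l)})
    {n : ℕ} (i j l : Fin n) :
    IsSemialgebraic ℝ
      {z : Fin n → ℝ | z i ∈ Ioo a b ∧ z j ∈ Ioo a b ∧ r (f (z i)) (f (z j)) (z l)} := by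
  have key : IsSemialgebraic ℝ
      {z : Fin n → ℝ | ∃ u v, (z i ∈ Ioo a b ∧ u = f (z i)) ∧ (z j ∈ Ioo a b ∧ v = f (z j)) ∧
        r u v (z l)} := by
    refine sa_exists (sa_exists ?_)
    exact sa_and (sa_graph hG (Fin.castSucc (Fin.castSucc i)) (Fin.castSucc (Fin.last n)))
      (sa_and (sa_graph hG (Fin.castSucc (Fin.castSucc j)) (Fin.last (n + 1)))
        (hr _ (Fin.castSucc (Fin.last n)) (Fin.last (n + 1)) (Fin.castSucc (Fin.castSucc l))))
  convert key using 1
  ext z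
  simp only [mem_setOf_eq]
  constructor
  · rintro ⟨hi, hj, h⟩
    exact ⟨f (z i), f (z j), ⟨hi, rfl⟩, ⟨hj, rfl⟩, h⟩
  · rintro ⟨u, v, ⟨hi, rfl⟩, ⟨hj, rfl⟩, h⟩
    exact ⟨hi, hj, h⟩

end Graph

/-! ### O-minimality of the real field on the line -/

section Line

variable {A : Set ℝ}

/-- **Finite boundary** (van den Dries 1998, Ch. 1 (3.3)(ii), for the o-minimal structure of real
semialgebraic sets, Ch. 2 (3.3)): a real-semialgebraic `A ⊆ ℝ` admits a finite set `F` such that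
every open interval `(p, q)` containing no point of `F` is contained in `A` or disjoint from `A`.
(Membership in `A` is locally constant off the finitely many roots of the nonzero univariate
polynomials of a presentation of `A`, `FibreLength.exists_card_le_locallyConst`; conclude by
connectedness of `(p, q)`.) [cite: Dries1998, Ch. 1 (3.3)(ii) and Ch. 2 (3.3)] -/
theorem exists_finset_Ioo_subset_or_disjoint
    (h : IsSemialgebraic ℝ {z : Fin 1 → ℝ | z 0 ∈ A}) :
    ∃ F : Finset ℝ, ∀ p q : ℝ, (∀ x ∈ F, x ∉ Ioo p q) →
      Ioo p q ⊆ A ∨ Disjoint (Ioo p q) A := by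
  obtain ⟨B, hB⟩ := FibreLength.exists_card_le_locallyConst (k := ℝ) (m := 0) h
  obtain ⟨R, -, hR⟩ := hB Fin.elim0
  refine ⟨R, fun p q hpq => ?_⟩
  have key : ∀ u : ℝ,
      ((Fin.snoc (Fin.elim0 : Fin 0 → ℝ) u : Fin 1 → ℝ) ∈ {z : Fin 1 → ℝ | z 0 ∈ A}) ↔ u ∈ A :=
    fun u => Iff.rfl
  refine FibreLength.subset_or_disjoint_of_isPreconnected isPreconnected_Ioo fun u hu => ?_
  have huR : u ∉ (R : Set ℝ) := fun h' => hpq u h' hu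
  filter_upwards [hR u huR] with u' hu'
  exact (key u').symm.trans (hu'.trans (key u))

/-- **Right germs are constant** (van den Dries 1998, Ch. 1 (3.3)(ii); Ch. 3 §1 "one of the parts
contains an interval `(x, c)`"): right of any point, a real-semialgebraic `A ⊆ ℝ` eventually
holds or eventually fails. [cite: Dries1998, Ch. 1 (3.3)(ii)] -/
theorem eventually_nhdsGT_mem_or (h : IsSemialgebraic ℝ {z : Fin 1 → ℝ | z 0 ∈ A}) (x : ℝ) :
    (∀ᶠ y in 𝓝[>] x, y ∈ A) ∨ (∀ᶠ y in 𝓝[>] x, y ∉ A) := by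
  obtain ⟨F, hF⟩ := exists_finset_Ioo_subset_or_disjoint h
  obtain ⟨c, hxc, hc⟩ := exists_gt_forall_notMem_Ioo F x
  rcases hF x c hc with h1 | h1
  · exact Or.inl (mem_nhdsGT_iff_exists_Ioo_subset.2 ⟨c, hxc, h1⟩)
  · refine Or.inr (mem_nhdsGT_iff_exists_Ioo_subset.2 ⟨c, hxc, fun y hy hAy => ?_⟩)
    exact Set.disjoint_left.1 h1 hy hAy

/-- **Left germs are constant** (van den Dries 1998, Ch. 1 (3.3)(ii)): left of any point, a
real-semialgebraic `A ⊆ ℝ` eventually holds or eventually fails.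
[cite: Dries1998, Ch. 1 (3.3)(ii)] -/
theorem eventually_nhdsLT_mem_or (h : IsSemialgebraic ℝ {z : Fin 1 → ℝ | z 0 ∈ A}) (x : ℝ) :
    (∀ᶠ y in 𝓝[<] x, y ∈ A) ∨ (∀ᶠ y in 𝓝[<] x, y ∉ A) := by
  obtain ⟨F, hF⟩ := exists_finset_Ioo_subset_or_disjoint h
  obtain ⟨c, hcx, hc⟩ := exists_lt_forall_notMem_Ioo F x
  rcases hF c x hc with h1 | h1
  · exact Or.inl (mem_nhdsLT_iff_exists_Ioo_subset.2 ⟨c, hcx, h1⟩)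
  · refine Or.inr (mem_nhdsLT_iff_exists_Ioo_subset.2 ⟨c, hcx, fun y hy hAy => ?_⟩)
    exact Set.disjoint_left.1 h1 hy hAy

/-- **A definable subset of the line containing no interval is finite** (van den Dries 1998,
Ch. 1 (3.2): definable sets are finite unions of points and intervals; the form "`X` must be
finite, since otherwise it would contain an interval" used throughout Ch. 3 §1).
[cite: Dries1998, Ch. 1 (3.2)] -/
theorem finite_of_forall_not_Ioo_subset (h : IsSemialgebraic ℝ {z : Fin 1 → ℝ | z 0 ∈ A})
    (hno : ∀ p q : ℝ, p < q → ¬ (Ioo p q ⊆ A)) : A.Finite := by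
  obtain ⟨F, hF⟩ := exists_finset_Ioo_subset_or_disjoint h
  refine F.finite_toSet.subset fun x hx => ?_
  by_contra hxF
  obtain ⟨p, q, hpx, hxq, hpq⟩ := exists_Ioo_forall_notMem_of_notMem F hxF
  rcases hF p q hpq with h1 | h1
  · exact hno p q (hpx.trans hxq) h1
  · exact Set.disjoint_left.1 h1 ⟨hpx, hxq⟩ hx

/-- **An infinite definable subset of the line contains an open interval** (van den Dries 1998,
Ch. 1 (3.2)). [cite: Dries1998, Ch. 1 (3.2)] -/
theorem exists_Ioo_subset_of_infinite (h : IsSemialgebraic ℝ {z : Fin 1 → ℝ | z 0 ∈ A})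
    (hA : A.Infinite) : ∃ p q : ℝ, p < q ∧ Ioo p q ⊆ A := by
  by_contra hno
  exact hA (finite_of_forall_not_Ioo_subset h fun p q hpq hsub => hno ⟨p, q, hpq, hsub⟩)

end Line

/-! ### The definable sets of the proof -/

section Formulas

variable {f : ℝ → ℝ} {a b : ℝ}

/-- **Right germ types are definable** (the sets `{x | Φ(x)}` of the proof of Lemma 2, van den
Dries 1998, Ch. 3 (1.5)): for a real-semialgebraic binary relation `r`, the set of `x ∈ (a, b)`
with `r (f y) (f x)` for all `y` in some right neighbourhood of `x` is real-semialgebraic — it is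
defined by `∃ c (x < c ∧ ∀ y (x < y < c → r(f y, f x)))`. [cite: Dries1998, Ch. 3 (1.5)] -/
theorem sa_setOf_eventually_nhdsGT
    (hG : IsSemialgebraic ℝ {w : Fin 2 → ℝ | w 0 ∈ Ioo a b ∧ w 1 = f (w 0)})
    {r : ℝ → ℝ → Prop}
    (hr : ∀ (m : ℕ) (i j : Fin m), IsSemialgebraic ℝ {w : Fin m → ℝ | r (w i) (w j)}) :
    IsSemialgebraic ℝ {z : Fin 1 → ℝ | z 0 ∈
      {x | x ∈ Ioo a b ∧ ∀ᶠ y in 𝓝[>] x, r (f y) (f x)}} := by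
  have key : IsSemialgebraic ℝ {z : Fin 1 → ℝ | z 0 ∈
      {x | x ∈ Ioo a b ∧ ∃ c, x < c ∧ ∀ y, (x < y ∧ y < c) →
        (y ∈ Ioo a b ∧ x ∈ Ioo a b ∧ r (f y) (f x))}} := by
    refine sa_and (sa_mem_Ioo 0 a b) (sa_exists ?_)
    refine sa_and (sa_lt 0 1) (sa_forall ?_)
    exact sa_imp (sa_and (sa_lt 0 2) (sa_lt 2 1)) (sa_frel hG hr 2 0)
  convert key using 1
  ext z
  simp only [mem_setOf_eq]
  refine and_congr_right fun hx => ⟨fun h => ?_, fun h => ?_⟩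
  · obtain ⟨c, hc, hsub⟩ := mem_nhdsGT_iff_exists_Ioo_subset.1
      (Filter.inter_mem (Ioo_mem_nhdsGT hx.2) h)
    exact ⟨c, hc, fun y hy => ⟨⟨hx.1.trans hy.1, (hsub hy).1.2⟩, hx, (hsub hy).2⟩⟩
  · obtain ⟨c, hc, h⟩ := h
    exact mem_nhdsGT_iff_exists_Ioo_subset.2 ⟨c, hc, fun y hy => (h y hy).2.2⟩

/-- **Left germ types are definable** (van den Dries 1998, Ch. 3 (1.5), the sets defined by the
formulas `Φ±±`): for a real-semialgebraic binary relation `r`, the set of `x ∈ (a, b)` with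
`r (f y) (f x)` for all `y` in some left neighbourhood of `x` is real-semialgebraic.
[cite: Dries1998, Ch. 3 (1.5)] -/
theorem sa_setOf_eventually_nhdsLT
    (hG : IsSemialgebraic ℝ {w : Fin 2 → ℝ | w 0 ∈ Ioo a b ∧ w 1 = f (w 0)})
    {r : ℝ → ℝ → Prop}
    (hr : ∀ (m : ℕ) (i j : Fin m), IsSemialgebraic ℝ {w : Fin m → ℝ | r (w i) (w j)}) :
    IsSemialgebraic ℝ {z : Fin 1 → ℝ | z 0 ∈
      {x | x ∈ Ioo a b ∧ ∀ᶠ y in 𝓝[<] x, r (f y) (f x)}} := by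
  have key : IsSemialgebraic ℝ {z : Fin 1 → ℝ | z 0 ∈
      {x | x ∈ Ioo a b ∧ ∃ c, c < x ∧ ∀ y, (c < y ∧ y < x) →
        (y ∈ Ioo a b ∧ x ∈ Ioo a b ∧ r (f y) (f x))}} := by
    refine sa_and (sa_mem_Ioo 0 a b) (sa_exists ?_)
    refine sa_and (sa_lt 1 0) (sa_forall ?_)
    exact sa_imp (sa_and (sa_lt 1 2) (sa_lt 2 0)) (sa_frel hG hr 2 0)
  convert key using 1
  ext z
  simp only [mem_setOf_eq]
  refine and_congr_right fun hx => ⟨fun h => ?_, fun h => ?_⟩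
  · obtain ⟨c, hc, hsub⟩ := mem_nhdsLT_iff_exists_Ioo_subset.1
      (Filter.inter_mem (Ioo_mem_nhdsLT hx.1) h)
    exact ⟨c, hc, fun y hy => ⟨⟨(hsub hy).1.1, hy.2.trans hx.2⟩, hx, (hsub hy).2⟩⟩
  · obtain ⟨c, hc, h⟩ := h
    exact mem_nhdsLT_iff_exists_Ioo_subset.2 ⟨c, hc, fun y hy => (h y hy).2.2⟩

/-- **The set of discontinuity points is definable** (used as in van den Dries 1998, Ch. 3
(1.4), for the set `X` of good points): `{x ∈ (a, b) | f is not continuous at x}` is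
real-semialgebraic, being defined by the negation of the `ε`-`δ` formula relative to `(a, b)`.
[cite: Dries1998, Ch. 3 (1.4)] -/
theorem sa_setOf_not_continuousAt
    (hG : IsSemialgebraic ℝ {w : Fin 2 → ℝ | w 0 ∈ Ioo a b ∧ w 1 = f (w 0)}) :
    IsSemialgebraic ℝ {z : Fin 1 → ℝ | z 0 ∈ {x | x ∈ Ioo a b ∧ ¬ ContinuousAt f x}} := by
  have hr3 : ∀ (m : ℕ) (i j l : Fin m),
      IsSemialgebraic ℝ {w : Fin m → ℝ | w i - w j < w l ∧ w j - w i < w l} :=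
    fun m i j l => sa_and (sa_sub_lt i j l) (sa_sub_lt j i l)
  have key : IsSemialgebraic ℝ {z : Fin 1 → ℝ | z 0 ∈
      {x | x ∈ Ioo a b ∧ ¬ (∀ ε, 0 < ε → ∃ δ, 0 < δ ∧ ∀ y,
        (y ∈ Ioo a b ∧ (y - x < δ ∧ x - y < δ)) →
          (y ∈ Ioo a b ∧ x ∈ Ioo a b ∧ (f y - f x < ε ∧ f x - f y < ε)))}} := by
    refine sa_and (sa_mem_Ioo 0 a b) (sa_not (sa_forall ?_))
    refine sa_imp (sa_const_lt 1 0) (sa_exists ?_)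
    refine sa_and (sa_const_lt 2 0) (sa_forall ?_)
    exact sa_imp (sa_and (sa_mem_Ioo 3 a b) (sa_and (sa_sub_lt 3 0 2) (sa_sub_lt 0 3 2)))
      (sa_frel₃ hG (r := fun u v e => u - v < e ∧ v - u < e) hr3 3 0 1)
  convert key using 1
  ext z
  simp only [mem_setOf_eq]
  refine and_congr_right fun hx => not_congr ?_
  rw [← continuousWithinAt_iff_continuousAt (Ioo_mem_nhds hx.1 hx.2),
    Metric.continuousWithinAt_iff]
  refine forall_congr' fun ε => forall_congr' fun hε => ⟨fun h => ?_, fun h => ?_⟩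
  · obtain ⟨δ, hδ, h⟩ := h
    refine ⟨δ, hδ, fun y hy => ⟨hy.1, hx, ?_⟩⟩
    have h' := h hy.1 (by rw [Real.dist_eq]; exact abs_sub_lt_iff.2 hy.2)
    rwa [Real.dist_eq, abs_sub_lt_iff] at h'
  · obtain ⟨δ, hδ, h⟩ := h
    refine ⟨δ, hδ, fun {y} hy hdist => ?_⟩
    rw [Real.dist_eq, abs_sub_lt_iff] at hdist ⊢
    exact (h y ⟨hy, hdist⟩).2.2

/-- **Images of intervals are definable** (van den Dries 1998, Ch. 3 (1.5), proof of Lemma 3: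
"`f(I)` is infinite, so contains an interval"): for `(p, q) ⊆ (a, b)` the set `f((p, q))` is
real-semialgebraic (a projection of the graph). [cite: Dries1998, Ch. 3 (1.5)] -/
theorem sa_image_Ioo (hG : IsSemialgebraic ℝ {w : Fin 2 → ℝ | w 0 ∈ Ioo a b ∧ w 1 = f (w 0)})
    {p q : ℝ} (hpq : Ioo p q ⊆ Ioo a b) :
    IsSemialgebraic ℝ {z : Fin 1 → ℝ | z 0 ∈ f '' Ioo p q} := by
  have key : IsSemialgebraic ℝ {z : Fin 1 → ℝ |
      ∃ x, (x ∈ Ioo a b ∧ z 0 = f x) ∧ (p < x ∧ x < q)} :=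
    sa_exists (sa_and (sa_graph hG 1 0) (sa_and (sa_const_lt 1 p) (sa_lt_const 1 q)))
  convert key using 1
  ext z
  simp only [mem_setOf_eq, mem_image]
  constructor
  · rintro ⟨x, hx, hfx⟩
    exact ⟨x, ⟨hpq hx, hfx.symm⟩, hx⟩
  · rintro ⟨x, ⟨-, hfx⟩, hx⟩
    exact ⟨x, hx, hfx.symm⟩

end Formulas

end SemialgebraicMonotonicity

end Literature.NumberTheory.Transcendental
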